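import Mathlib
import HarnessLib

/-!
# Sections of the endomorphism bundle `End(TM)`: chartwise packaging lemmas
(helper file 1 for stub `stub_tameJ` of line `cross-cap-laurent`, crux `GromovRecognitionRelEnd`,
item stmt-SmoothPoincare4-11009)

The smoothness field `contMDiff'` of the tree's `Literature.Geometry.Symplectic.AlmostComplexStructure`
asks that `x ↦ (x, J x)` be a `C^∞` map into the total space of Mathlib's hom bundle
`fun x ↦ TangentSpace I x →L[ℝ] TangentSpace I x` (model fibre `E →L[ℝ] E`). This file packages
that condition chartwise, once and for all (it is also what the cap worker of the same line needs
for the glued structure `JX`):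

* `contMDiffAt_endSection_iff` — `x ↦ (x, A x)` is `C^∞` at `x₀` iff the *trivialised expression*
  `x ↦ φₓ ∘ A x ∘ φₓ⁻¹` is `C^∞` at `x₀` as a map `M → (E →L[ℝ] E)`, where
  `φₓ = (trivializationAt E (TangentSpace I) x₀).continuousLinearMapAt ℝ x` is the tangent
  trivialisation at `x₀` (`= D(extChartAt I x₀)(x)`, Mathlib's
  `TangentBundle.continuousLinearMapAt_trivializationAt`) and `φₓ⁻¹ = symmL`;
* `contMDiffOn_endSection_conj` — conversely a `C^∞` matrix-valued function `B` on the chart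
  domain of `x₀` defines the `C^∞` local section `x ↦ φₓ⁻¹ ∘ B x ∘ φₓ` there (the endomorphism
  analogue of the tree's `contMDiffOn_precomp_comp_continuousLinearMapAt` for bilinear forms);
* `contMDiff_endSection_map` — **equivariant fibre maps preserve smooth sections**: if
  `Φ : (E →L E) → (E →L E)` commutes with conjugation by linear automorphisms and is `C^∞` (as a
  map of normed spaces) at every value `A x`, then `x ↦ Φ (A x)` is a `C^∞` section whenever `A`
  is (used with `Φ` = the polar-decomposition retraction `A ↦ A (-A²)^{-1/2}` onto almost complex
  structures);
* `inTangentCoordinates_model_target`, `contMDiffAt_mfderiv_comp_symmL` — for a map `f : M → E'`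
  into a vector space, `x ↦ df_x ∘ φₓ⁻¹` (the derivative of `f ∘ (extChartAt I x₀)⁻¹` read on `M`)
  is `C^∞` at `x₀` when `f` is (Mathlib's `ContMDiffAt.mfderiv_const` with the identity
  trivialisation of `TE'` removed);
* `helper_endSectionMap` — the registered helper sub-goal of this file: `contMDiff_endSection_map` for
  `4`-manifolds modelled on `ℝ⁴`;
* `continuousLinearMapAt_trivializationAt_self`, `symmL_trivializationAt_self` — at the centre the
  tangent trivialisation is the identity; `symmL_trivializationAt_ne_zero` — `φₓ⁻¹` is injective
  over the chart domain (the companion statement for `φₓ` is the tree's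
  `Literature.Geometry.Riemannian.continuousLinearMapAt_tangent_ne_zero`).

Everything is proved; no definition, no named fact. Source pattern: J. M. Lee, *Introduction to
Smooth Manifolds* (2013), Prop. 10.22 / Lemma 10.32 (local frame criterion for smoothness of
sections and of bundle maps) [LeeSmoothManifolds2013]; Mathlib `contMDiffAt_hom_bundle`,
`Trivialization.contMDiffOn_section_iff`.
-/

noncomputable section

-- the registered namespace `Summit.SmoothPoincare4.SmoothPoincare4.Theorems…` repeats a component
set_option linter.dupNamespace false

open scoped Manifold ContDiff Topology
open Bundle Set Function Filter

namespace Summit.SmoothPoincare4.SmoothPoincare4.Theorems.GromovRecognitionRelEnd.CrossCapLaurent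

variable {E : Type*} [NormedAddCommGroup E] [NormedSpace ℝ E] {H : Type*} [TopologicalSpace H]
  {I : ModelWithCorners ℝ E H} {M : Type*} [TopologicalSpace M] [ChartedSpace H M]
  [IsManifold I ∞ M]

/-! ### The tangent trivialisation at the centre of a chart -/

/-- At its centre `x₀` the tangent trivialisation at `x₀` is the identity of `T_{x₀} M = E`
(the coordinate change of a chart with itself). [folklore] -/
theorem continuousLinearMapAt_trivializationAt_self (x₀ : M) :
    (trivializationAt E (TangentSpace I) x₀).continuousLinearMapAt ℝ x₀ =
      ContinuousLinearMap.id ℝ E := by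
  rw [TangentBundle.continuousLinearMapAt_trivializationAt_eq_core (mem_chart_source H x₀)]
  ext v
  exact (tangentBundleCore I M).coordChange_self (achart H x₀) x₀ (mem_chart_source H x₀) v

/-- At its centre `x₀` the inverse tangent trivialisation at `x₀` is the identity.
[folklore] -/
theorem symmL_trivializationAt_self (x₀ : M) :
    (trivializationAt E (TangentSpace I) x₀).symmL ℝ x₀ = ContinuousLinearMap.id ℝ E := by
  rw [TangentBundle.symmL_trivializationAt_eq_core (mem_chart_source H x₀)]
  ext v
  exact (tangentBundleCore I M).coordChange_self (achart H x₀) x₀ (mem_chart_source H x₀) v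

/-- Over the chart domain of `x₀` the inverse tangent trivialisation `φₓ⁻¹ : E →L[ℝ] T_x M` is
injective. [folklore] -/
theorem symmL_trivializationAt_ne_zero {x₀ x : M} (hx : x ∈ (chartAt H x₀).source) {v : E}
    (hv : v ≠ 0) : (trivializationAt E (TangentSpace I) x₀).symmL ℝ x v ≠ 0 := by
  intro h
  apply hv
  have hx' : x ∈ (trivializationAt E (TangentSpace I) x₀).baseSet := by simpa using hx
  rw [← (trivializationAt E (TangentSpace I) x₀).continuousLinearMapAt_symmL (R := ℝ) hx' v, h,
    map_zero]

/-! ### Sections of `End(TM)` in a trivialisation -/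

/-- **Smoothness of a section of `End(TM)` at a point, chartwise.** The section `x ↦ (x, A x)`
of the endomorphism bundle is `C^∞` at `x₀` iff its expression in the tangent trivialisation at
`x₀`, `x ↦ φₓ ∘ A x ∘ φₓ⁻¹ : M → (E →L[ℝ] E)`, is `C^∞` at `x₀` (Mathlib's
`contMDiffAt_hom_bundle`, whose base component is the identity). Lee (2013), Prop. 10.22.
[cite: LeeSmoothManifolds2013, Prop. 10.22] -/
theorem contMDiffAt_endSection_iff (A : (x : M) → TangentSpace I x →L[ℝ] TangentSpace I x)
    (x₀ : M) :
    ContMDiffAt I (I.prod 𝓘(ℝ, E →L[ℝ] E)) ∞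
        (fun x ↦ TotalSpace.mk' (E →L[ℝ] E)
          (E := fun x : M ↦ TangentSpace I x →L[ℝ] TangentSpace I x) x (A x)) x₀ ↔
      ContMDiffAt I 𝓘(ℝ, E →L[ℝ] E) ∞
        (fun x ↦ ((trivializationAt E (TangentSpace I) x₀).continuousLinearMapAt ℝ x).comp
          ((A x).comp ((trivializationAt E (TangentSpace I) x₀).symmL ℝ x))) x₀ := by
  rw [contMDiffAt_hom_bundle]
  exact ⟨fun h ↦ h.2, fun h ↦ ⟨contMDiffAt_id, h⟩⟩

/-- **A smooth matrix-valued function on a chart domain defines a smooth local section of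
`End(TM)`.** For `B : M → (E →L[ℝ] E)` of class `C^∞` on the chart domain of `x₀`, the section
`x ↦ φₓ⁻¹ ∘ B x ∘ φₓ` (`φₓ` the tangent trivialisation at `x₀`) is `C^∞` on that domain: in the
trivialisation at `x₀` of `End(TM)` it reads `B` itself, since `φₓ ∘ φₓ⁻¹ = id` over the base set.
Lee (2013), Prop. 10.22 (local frame criterion). [cite: LeeSmoothManifolds2013, Prop. 10.22] -/
theorem contMDiffOn_endSection_conj (B : M → E →L[ℝ] E) (x₀ : M)
    (hB : ContMDiffOn I 𝓘(ℝ, E →L[ℝ] E) ∞ B (chartAt H x₀).source) :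
    ContMDiffOn I (I.prod 𝓘(ℝ, E →L[ℝ] E)) ∞
      (fun x ↦ TotalSpace.mk' (E →L[ℝ] E)
        (E := fun x : M ↦ TangentSpace I x →L[ℝ] TangentSpace I x) x
        (((trivializationAt E (TangentSpace I) x₀).symmL ℝ x).comp ((B x).comp
          ((trivializationAt E (TangentSpace I) x₀).continuousLinearMapAt ℝ x))))
      (chartAt H x₀).source := by
  refine ((trivializationAt (E →L[ℝ] E)
    (fun x : M ↦ TangentSpace I x →L[ℝ] TangentSpace I x) x₀).contMDiffOn_section_iff
      (chartAt H x₀).open_source ?_).2 ?_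
  · intro x hx
    simpa using hx
  · refine hB.congr fun x hx ↦ ?_
    have hx' : x ∈ (trivializationAt E (TangentSpace I) x₀).baseSet := by simpa using hx
    rw [hom_trivializationAt_apply]
    ext v
    simp only [ContinuousLinearMap.inCoordinates, ContinuousLinearMap.coe_comp, comp_apply]
    rw [(trivializationAt E (TangentSpace I) x₀).continuousLinearMapAt_symmL hx',
      (trivializationAt E (TangentSpace I) x₀).continuousLinearMapAt_symmL hx']

/-- **Equivariant smooth fibre maps send smooth sections of `End(TM)` to smooth sections.** Let
`Φ : (E →L E) → (E →L E)` commute with conjugation by continuous linear automorphisms,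
`Φ (T ∘ L ∘ T') = T ∘ Φ L ∘ T'` whenever `T ∘ T' = T' ∘ T = id`, let `A` be a `C^∞` section of `End(TM)` and let `Φ` be `C^∞`
(as a map between normed spaces) at every value `A x`. Then `x ↦ Φ (A x)` is a `C^∞` section: in
the tangent trivialisation at `x₀` its expression is `Φ` applied to the expression of `A`
(equivariance, the trivialisation being fibrewise a linear automorphism of `E`). This is how a
pointwise `GL`-equivariant construction (e.g. the polar part `A ↦ A(-A²)^{-1/2}`, McDuff–Salamon
2017 Prop. 2.5.6) is shown to produce a smooth almost complex structure. [folklore] -/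
theorem contMDiff_endSection_map {Φ : (E →L[ℝ] E) → (E →L[ℝ] E)}
    {A : (x : M) → TangentSpace I x →L[ℝ] TangentSpace I x}
    (hA : ContMDiff I (I.prod 𝓘(ℝ, E →L[ℝ] E)) ∞
      (fun x ↦ TotalSpace.mk' (E →L[ℝ] E)
        (E := fun x : M ↦ TangentSpace I x →L[ℝ] TangentSpace I x) x (A x)))
    (hΦ : ∀ x, ContDiffAt ℝ ∞ Φ (A x))
    (hconj : ∀ (T T' : E →L[ℝ] E), T.comp T' = ContinuousLinearMap.id ℝ E →
      T'.comp T = ContinuousLinearMap.id ℝ E → ∀ L : E →L[ℝ] E,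
      Φ (T.comp (L.comp T')) = T.comp ((Φ L).comp T')) :
    ContMDiff I (I.prod 𝓘(ℝ, E →L[ℝ] E)) ∞
      (fun x ↦ TotalSpace.mk' (E →L[ℝ] E)
        (E := fun x : M ↦ TangentSpace I x →L[ℝ] TangentSpace I x) x (Φ (A x))) := by
  intro x₀
  have h2 := (contMDiffAt_endSection_iff A x₀).1 (hA x₀)
  rw [contMDiffAt_endSection_iff]
  set F : M → (E →L[ℝ] E) := fun x ↦
    ((trivializationAt E (TangentSpace I) x₀).continuousLinearMapAt ℝ x).comp
      ((A x).comp ((trivializationAt E (TangentSpace I) x₀).symmL ℝ x)) with hF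
  -- the value of the trivialised expression of `A` at the centre is `A x₀`
  have hval : F x₀ = A x₀ := by
    simp only [hF]
    rw [continuousLinearMapAt_trivializationAt_self, symmL_trivializationAt_self]
    ext v
    rfl
  have hΦ' : ContDiffAt ℝ ∞ Φ (F x₀) := by
    rw [hval]; exact hΦ x₀
  refine (hΦ'.comp_contMDiffAt h2).congr_of_eventuallyEq ?_
  filter_upwards [(chartAt H x₀).open_source.mem_nhds (mem_chart_source H x₀)] with x hx
  have hx' : x ∈ (trivializationAt E (TangentSpace I) x₀).baseSet := by simpa using hx
  have hTT' : ((trivializationAt E (TangentSpace I) x₀).continuousLinearMapAt ℝ x).comp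
      ((trivializationAt E (TangentSpace I) x₀).symmL ℝ x) = ContinuousLinearMap.id ℝ E := by
    ext v
    exact (trivializationAt E (TangentSpace I) x₀).continuousLinearMapAt_symmL hx' v
  have hT'T : ((trivializationAt E (TangentSpace I) x₀).symmL ℝ x).comp
      ((trivializationAt E (TangentSpace I) x₀).continuousLinearMapAt ℝ x) =
        ContinuousLinearMap.id ℝ E := by
    ext v
    exact (trivializationAt E (TangentSpace I) x₀).symmL_continuousLinearMapAt hx' v
  exact (hconj _ _ hTT' hT'T (A x)).symm

/-! ### The derivative of a vector-valued map, read in the tangent trivialisation -/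

/-- For a map `f : M → E'` into a normed space (tangent spaces of `E'` trivialised by the identity)
Mathlib's `inTangentCoordinates I 𝓘(ℝ, E') id f ϕ x₀ x` is just `ϕ x ∘ φₓ⁻¹`, `φₓ⁻¹` the inverse
tangent trivialisation of `M` at `x₀`. [folklore] -/
theorem inTangentCoordinates_model_target {E' : Type*} [NormedAddCommGroup E']
    [NormedSpace ℝ E'] (f : M → E') (ϕ : M → E →L[ℝ] E') (x₀ x : M) :
    inTangentCoordinates I 𝓘(ℝ, E') id f ϕ x₀ x =
      (ϕ x).comp ((trivializationAt E (TangentSpace I) x₀).symmL ℝ x) := by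
  simp only [inTangentCoordinates, ContinuousLinearMap.inCoordinates,
    TangentBundle.continuousLinearMapAt_model_space, id]
  ext v
  rfl

/-- **The differential read in a chart is smooth.** If `f : M → E'` is `C^∞` at `x₀`, then
`x ↦ df_x ∘ φₓ⁻¹ : M → (E →L[ℝ] E')` — the derivative of `f ∘ (extChartAt I x₀)⁻¹` at
`extChartAt I x₀ x`, read back on `M` — is `C^∞` at `x₀` (Mathlib's `ContMDiffAt.mfderiv_const`).
[folklore] -/
theorem contMDiffAt_mfderiv_comp_symmL {E' : Type*} [NormedAddCommGroup E'] [NormedSpace ℝ E']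
    {f : M → E'} {x₀ : M} (hf : ContMDiffAt I 𝓘(ℝ, E') ∞ f x₀) :
    ContMDiffAt (M' := E →L[ℝ] E') I 𝓘(ℝ, E →L[ℝ] E') ∞
      (fun x ↦ (mfderiv I 𝓘(ℝ, E') f x).comp
        ((trivializationAt E (TangentSpace I) x₀).symmL ℝ x)) x₀ := by
  have h := hf.mfderiv_const (m := ∞) le_rfl
  have heq : inTangentCoordinates I 𝓘(ℝ, E') id f (mfderiv I 𝓘(ℝ, E') f) x₀ =
      fun x ↦ (mfderiv I 𝓘(ℝ, E') f x).comp
        ((trivializationAt E (TangentSpace I) x₀).symmL ℝ x) :=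
    funext fun x ↦ inTangentCoordinates_model_target f (mfderiv I 𝓘(ℝ, E') f) x₀ x
  rwa [heq] at h

/-! ### Registered helper sub-goal -/

/-- **Registered helper sub-goal `helper_endSectionMap`** (the packaging lemma
`contMDiff_endSection_map` on a `4`-manifold modelled on `ℝ⁴`, the shape used by the stubs of the
line): a conjugation-equivariant fibre map `Φ` of `End(ℝ⁴)`, smooth at the values of a `C^∞`
section `A` of `End(TM)`, sends `A` to a `C^∞` section `x ↦ Φ (A x)`. [folklore] -/
theorem helper_endSectionMap : ∀ (M : Type) [TopologicalSpace M]
    [ChartedSpace (EuclideanSpace ℝ (Fin 4)) M] [IsManifold (𝓡 4) ∞ M]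
    (Φ : (EuclideanSpace ℝ (Fin 4) →L[ℝ] EuclideanSpace ℝ (Fin 4)) →
      (EuclideanSpace ℝ (Fin 4) →L[ℝ] EuclideanSpace ℝ (Fin 4)))
    (A : (x : M) → TangentSpace (𝓡 4) x →L[ℝ] TangentSpace (𝓡 4) x),
    ContMDiff (𝓡 4) ((𝓡 4).prod 𝓘(ℝ, EuclideanSpace ℝ (Fin 4) →L[ℝ] EuclideanSpace ℝ (Fin 4))) ∞
      (fun x ↦ Bundle.TotalSpace.mk' (EuclideanSpace ℝ (Fin 4) →L[ℝ] EuclideanSpace ℝ (Fin 4))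
        (E := fun x : M ↦ TangentSpace (𝓡 4) x →L[ℝ] TangentSpace (𝓡 4) x) x (A x)) →
    (∀ x, ContDiffAt ℝ ∞ Φ (A x)) →
    (∀ (T T' : EuclideanSpace ℝ (Fin 4) →L[ℝ] EuclideanSpace ℝ (Fin 4)),
      T.comp T' = ContinuousLinearMap.id ℝ (EuclideanSpace ℝ (Fin 4)) →
      T'.comp T = ContinuousLinearMap.id ℝ (EuclideanSpace ℝ (Fin 4)) →
      ∀ L : EuclideanSpace ℝ (Fin 4) →L[ℝ] EuclideanSpace ℝ (Fin 4),
        Φ (T.comp (L.comp T')) = T.comp ((Φ L).comp T')) →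
    ContMDiff (𝓡 4) ((𝓡 4).prod 𝓘(ℝ, EuclideanSpace ℝ (Fin 4) →L[ℝ] EuclideanSpace ℝ (Fin 4))) ∞
      (fun x ↦ Bundle.TotalSpace.mk' (EuclideanSpace ℝ (Fin 4) →L[ℝ] EuclideanSpace ℝ (Fin 4))
        (E := fun x : M ↦ TangentSpace (𝓡 4) x →L[ℝ] TangentSpace (𝓡 4) x) x (Φ (A x))) :=
  fun _ _ _ _ _ _ hA hΦ hconj ↦ contMDiff_endSection_map hA hΦ hconj

end Summit.SmoothPoincare4.SmoothPoincare4.Theorems.GromovRecognitionRelEnd.CrossCapLaurent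

end
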